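import Literature.NumberTheory.EllipticCurves.Rank1Residual.Typed.X11Visibility
import Literature.NumberTheory.EllipticCurves.NonEisensteinPrimeOfSurjective
import HarnessLib

/-!
# Rank `0`, any class: `BSD(E,p)` from Wuthrich's upper bound + Cassels–Tate + a VISIBLE element of `Ш(E)[p]` (cell `b2b-bsdres`)

HONEST FRAMING (run/shared/lean/b2b/bsd-rank1-residual/, verbatim): the goal of the cell is to
DELETE the COMBINATION-SHAPED residual classes for ALL analytic-rank `≤ 1` elliptic curves over `ℚ`
— "full BSD formula for every rank `≤ 1` curve in class C" assembled STRICTLY from published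
theorems — so that the rank-`≤ 1` remainder becomes exactly the CONSTRUCTION-SHAPED classes, which
are TYPED (missing-input `Prop`s), NOT attempted. This is not "finishing BSD".

Theorems only (no definition, no new named fact; prover x11a gen 9). CLASS-AGNOSTIC companion of
`Typed/X11Visibility.lean`: the lever `bsdp_of_wuthrich_of_casselsTate_of_dvd` of
`Typed/CasselsLowerBound.lean` (prover x11b: rank `0`, odd NON-additive `p`, `ρ̄_{E,p}` surjective or
Borel, `ord_p #Ш_an ≤ 2`, and ONE certificate `p ∣ #Ш(E/ℚ)` ⇒ `BSD(E,p)`, from Wuthrich 2014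
Prop. 21 + Cassels–Tate + Gross–Zagier–Kolyvagin + modularity) composed with the KERNEL visibility
theorem `WeierstrassCurve.exists_sha_ne_zero_of_congr_of_rank` (`CongruenceVisibility.lean`,
`CongruenceVisibilityLocalFactors.lean`: for an odd prime `p`, a `Γ_ℚ`-isomorphism
`θ : E'[p] ≅ E[p]`, a finite set `S` of primes outside which `E, E'` have good reduction and which
contains `p`, `E(ℚ)` finite of order prime to `p`, `E'(ℚ_v)[p] = 0` for `v ∈ S` and
`rank E'(ℚ) ≥ 2`, the group `Ш(E/ℚ)` has a non-zero element killed by `p` — the dimension count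
of Cremona–Mazur 2000 §3 / Agashe–Stein 2002 Thm. 3.1 with NO condition at `p`). So wherever the
cell's rank-`0` residue is "the LOWER bound at a pair with `p² ‖ #Ш_an`" — X11 at `p = 3`
(`5808h1`, `8664o1`), X6/X7/X8 and the Borel class X2 at `p = 3` (`Typed/CasselsLowerBound.lean`,
module docstring: 22 pairs below `10⁴`, all `#Ш_an = 9`), X11 at `p ≥ 5` (`Typed/X11Visibility.lean`)
— a `p`-CONGRUENT CURVE OF RANK `≥ 2` with no `ℚ_v`-rational `p`-torsion on `S` is a complete
per-curve certificate, checkable by finite computations (Sturm-bound congruence of two newforms,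
two independent points, roots of `ψ_p` over `ℚ_v`), independent of (and cross-checking) a
`p`-descent. This is the situation of Cremona–Mazur's Table 1 ("`Ш` of order `p²` explained by a
congruent rank-`2` curve"), made unconditional pair by pair.

* `bsdp_of_wuthrich_of_congr` — general form: image surjective-or-Borel (`himg`), with the
  coprimality `p ∤ #E(ℚ)` an explicit hypothesis (a Borel curve may have rational `p`-torsion; then
  the count of `exists_sha_ne_zero_of_congr` with `[E(ℚ):pE(ℚ)] = p` is the tool, not this form);
* `bsdp_of_wuthrich_of_congr_of_surj` — surjective image: `p ∤ #E(ℚ)` is automatic (surjective ⇒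
  irreducible ⇒ no rational `p`-torsion, Mazur; tree
  `hasIrreducibleModPGaloisRep_of_hasSurjectiveModNGaloisRep`, `coprime_natCard_point_of_irr`).
NOT class theorems (per-curve partner data); no label changes; the lane certifies.

References: Cremona–Mazur 2000 §3, Table 1 [CremonaMazur2000]; Agashe–Stein 2002 Thm. 3.1
[AgasheStein2002]; Wuthrich 2014 Prop. 21 [Wuthrich2014]; Silverman AEC X.4.14 [SilvermanAEC2009];
Miller 2011 Def. 1.1 [Miller2011LMS]; cell files `Typed/CasselsLowerBound.lean` (x11b),
`Typed/X11Visibility.lean`, `b2b-bsdres-x11a/REPORT-g9.md`.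
-/

noncomputable section

open scoped Classical

open WeierstrassCurve Literature.NumberTheory.EllipticCurves
  Literature.NumberTheory.EllipticCurves.Rank1Residual
  Literature.NumberTheory.EllipticCurves.Wuthrich2014
open NumberField IsDedekindDomain

namespace Literature.NumberTheory.EllipticCurves.Rank1Residual.Typed

variable (W : WeierstrassCurve ℚ) [W.IsElliptic] [W.IsGloballyMinimal] (p : ℕ) [Fact p.Prime]

/-- **Rank `0`, odd non-additive `p`, surjective-or-Borel image, `ord_p #Ш_an ≤ 2`: `BSD(E,p)` from
PUBLISHED theorems plus a `p`-CONGRUENT CURVE OF RANK `≥ 2`** (general form; `p ∤ #E(ℚ)` explicit).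
Published binders: Wuthrich 2014 Prop. 21 (`hW`), Cassels–Tate (`hCT`), GZK (`hGZK`), modularity
(`hmod`); kernel: `exists_sha_ne_zero_of_congr_of_rank` + `bsdp_of_wuthrich_of_casselsTate_of_dvd`.
Per-curve data: `W'`, `θ`, `hrank`, `S`, `hS`, `hloc`, `hcop`. NOT a class theorem.
[cite: Wuthrich2014, Prop. 21 (p. 400)] [cite: SilvermanAEC2009, Thm. X.4.14]
[cite: CremonaMazur2000, §3 and Table 1] [cite: AgasheStein2002, Thm. 3.1]
[cite: Miller2011LMS, §1 and Def. 1.1] -/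
theorem bsdp_of_wuthrich_of_congr (hCT : exists_casselsTate_pairing (K := ℚ))
    (hW : sha_dvd_analyticSha) (hGZK : rank_eq_analyticRank_of_analyticRank_le_one)
    (hmod : hasEntireLFunction_rat) (hp : p ≠ 2) (hr : W.analyticRank = 0)
    (hadd : ¬ ((W.baseChange ℚ_[p]).minimal ℤ_[p]).HasAdditiveReduction ℤ_[p])
    (himg : ¬ W.HasIrreducibleModPGaloisRep p ∨ W.HasSurjectiveModNGaloisRep p)
    (hcop : (Nat.card W.toAffine.Point).Coprime p)
    {q : ℚ} (hq : shaAn W = (q : ℂ)) (hv : padicValRat p q ≤ 2)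
    (W' : WeierstrassCurve ℚ) [W'.IsElliptic]
    (θ : geomTorsion W' (p : ℤ) ≃+ geomTorsion W (p : ℤ))
    (hθ : ∀ (σ : Field.absoluteGaloisGroup ℚ) (P : geomTorsion W' (p : ℤ)), θ (σ • P) = σ • θ P)
    (hrank : 2 ≤ W'.mordellWeilRank) (S : Finset (HeightOneSpectrum (𝓞 ℚ)))
    (hS : ∀ v : HeightOneSpectrum (𝓞 ℚ), v ∉ S →
      W.HasGoodReductionAt v ∧ W'.HasGoodReductionAt v ∧ (p : 𝓞 ℚ) ∉ v.asIdeal)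
    (hloc : ∀ v ∈ S, Nat.card (nsmulAddMonoidHom p :
      (W'.baseChange (v.adicCompletion ℚ)).toAffine.Point →+ _).ker = 1) :
    BSDp W p := by
  haveI : Finite W.toAffine.Point := finite_point_of_analyticRank_eq_zero W hGZK hr
  have hrank' : Module.finrank ℚ ℚ + 1 ≤ W'.mordellWeilRank := by rwa [Module.finrank_self]
  exact bsdp_of_wuthrich_of_casselsTate_of_dvd W p hCT hW hGZK hmod hp hr hadd himg hq hv
    (dvd_shaOrder_of_exists_torsion W p
      (W.exists_sha_ne_zero_of_congr_of_rank W' hp θ hθ S hS ‹_› hcop hrank' hloc))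

/-- **Rank `0`, odd non-additive `p`, SURJECTIVE `ρ̄_{E,p}`, `ord_p #Ш_an ≤ 2`: `BSD(E,p)` from
PUBLISHED theorems plus a `p`-congruent curve of rank `≥ 2`** — `p ∤ #E(ℚ)` is automatic
(surjective ⇒ irreducible ⇒ no rational `p`-torsion). Covers every rank-`0` residue pair of the
cell with surjective image and `p² ‖ #Ш_an` at a good or multiplicative `p` (X11 at `p = 3` and at
`p ≥ 5`, X6/X7/X8 at `p = 3`), given a partner. NOT a class theorem.
[cite: Wuthrich2014, Prop. 21 (p. 400)] [cite: SilvermanAEC2009, Thm. X.4.14]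
[cite: CremonaMazur2000, §3 and Table 1] [cite: Mazur1977, Ch. III §5, p. 157] -/
theorem bsdp_of_wuthrich_of_congr_of_surj (hCT : exists_casselsTate_pairing (K := ℚ))
    (hW : sha_dvd_analyticSha) (hGZK : rank_eq_analyticRank_of_analyticRank_le_one)
    (hmod : hasEntireLFunction_rat) (hp : p ≠ 2) (hr : W.analyticRank = 0)
    (hadd : ¬ ((W.baseChange ℚ_[p]).minimal ℤ_[p]).HasAdditiveReduction ℤ_[p])
    (hsurj : Surj W p) {q : ℚ} (hq : shaAn W = (q : ℂ)) (hv : padicValRat p q ≤ 2)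
    (W' : WeierstrassCurve ℚ) [W'.IsElliptic]
    (θ : geomTorsion W' (p : ℤ) ≃+ geomTorsion W (p : ℤ))
    (hθ : ∀ (σ : Field.absoluteGaloisGroup ℚ) (P : geomTorsion W' (p : ℤ)), θ (σ • P) = σ • θ P)
    (hrank : 2 ≤ W'.mordellWeilRank) (S : Finset (HeightOneSpectrum (𝓞 ℚ)))
    (hS : ∀ v : HeightOneSpectrum (𝓞 ℚ), v ∉ S →
      W.HasGoodReductionAt v ∧ W'.HasGoodReductionAt v ∧ (p : 𝓞 ℚ) ∉ v.asIdeal)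
    (hloc : ∀ v ∈ S, Nat.card (nsmulAddMonoidHom p :
      (W'.baseChange (v.adicCompletion ℚ)).toAffine.Point →+ _).ker = 1) :
    BSDp W p := by
  haveI : Finite W.toAffine.Point := finite_point_of_analyticRank_eq_zero W hGZK hr
  haveI : NeZero (p : ℚ) := ⟨by exact_mod_cast (Fact.out : p.Prime).ne_zero⟩
  have hirr : Irr W p := hasIrreducibleModPGaloisRep_of_hasSurjectiveModNGaloisRep W p hsurj
  exact bsdp_of_wuthrich_of_congr W p hCT hW hGZK hmod hp hr hadd (Or.inr hsurj)
    (coprime_natCard_point_of_irr W p hirr) hq hv W' θ hθ hrank S hS hloc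

end Literature.NumberTheory.EllipticCurves.Rank1Residual.Typed
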